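import Literature.NumberTheory.Automorphic.Liu2021.LemD1AsPrintedIndexedNonVacuityDetLineDecision
import HarnessLib

/-!
# [Liu2021, App. D Lemma D.1 (1) ∧ (3)] AS PRINTED, JOINTLY, the `χ`-conjunct deciding ALONE — EVERY rank `N ≥ 3`, EVERY finite place:
# a det-line character `Λ = θ_w ∘ det_w` with PRESCRIBED NON-TRIVIAL central character

Reproduction ∕ bookkeeping (Literature, THEOREMS ONLY: no definition, no record, no named fact, no `sorry`; nothing is
asserted about Liu's oscillator representations or about the tree's constructed local Weil carriers).

✔ `…LevelCarrier.exists_lemD1IndexedFamily_item1_and_lemD1_3_chi` gives the `χ`-alone certificate for `N` ODD at every place (the level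
character `θ_w` has `θ_w(−1) ≠ 1`, and the central character `χ_Λ(z) = θ_w(z_w^N)` of `Λ = θ_w ∘ det_w` has `χ_Λ(−1) = θ_w(−1)^N = −1`);
its «What this does NOT give» names «the `χ`-alone certificate for `N` even (`χ_Λ(−1) = θ_w(−1)^N = 1`)».  THIS FILE removes the parity
condition by choosing the separating CENTRAL element and the level character together:

* §1 (local ∕ global helpers) **`exists_character_apply_ne_one_of_level`** — for EVERY unit `t ≠ 1` of `E_w` with `v_w(t − 1) ≤ 1` a
  character `θ` of `E_wˣ` with open kernel, finite order, unitary, trivial on `{x : v_w(x − 1) < v_w(t − 1)}` and `θ(t) ≠ 1` (characters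
  of the finite abelian group `𝒪_wˣ ∕ U_{v(t−1)}` separate points, Mathlib `CommGroup.exists_apply_ne_one_of_hasEnoughRootsOfUnity`;
  ✔ `…LevelTwist.exists_level_character` is the case `t = −1`); **`exists_mul_conj_eq_one_valuation_sub_one_lt_of_ne_zero`** — a GLOBAL
  norm-one principal unit `a = (1 + u)/(1 − u)` with `0 ≠ v_w(a − 1) < τ` for ANY threshold `τ ≠ 0` (✔ `…WildCarrier` had `τ = 1`);
  **`pow_sub_one_ne_zero_of_valued_sub_one_lt`** — `v_w(y − 1) < v_w(N)`, `y ≠ 1` ⟹ `y^N ≠ 1` (`Σ_{i<N} y^i ≡ N`).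
* §2 **`exists_carrier_character_central_ne_one`** — at ANY place `w ∣ v`, ANY `N ≥ 2`: a character `Λ = θ ∘ pr_w ∘ det` of
  `U(V)(F_v) = S.U` and `χ_Λ ∈ ChiSet S` (`χ_Λ(z) = θ(z_w^N)`) with `Λ ∘ S.scalar = χ_Λ`, `Λ = 1` on an open neighbourhood of `1`,
  `Λ(g₀) ≠ 1` for some `g₀`, AND `χ_Λ(ι(a)) = θ(a_w^N) ≠ 1` — `θ` chosen AFTER `t = a_w^N ≠ 1` (`v_w(a − 1) < v_w(N)`).
* §3 **`exists_lemD1IndexedFamily_item1_and_lemD1_3_chi`** — EVERY `N ≥ 3`, EVERY place, every `μ ∈ MuSet S`, every representative `e`: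
  labels `(μ, e, 1)`, `(μ, e, χ_Λ)`, carriers the trivial line and the line of `Λ`: (1) member by member, (3) for all four pairs, `μ` and
  `ε` EQUAL, `χ` DIFFERENT, `ω`'s non-isomorphic; hypothesis-free **`not_forall_chi_eq`** (the records do not force «all members carry the
  same `χ`») and **`not_forall_mu_ne_or_not_sameClass_of_not_areIsomorphicRep`** («non-isomorphic ⟹ different `μ` or different `ε`-class»
  is not forced).
* §4 the CM rows (`L` CM, `F = L⁺`): the rows' OWN `μ_v = localMu L (toHeckeCharacter L ψ) v` in BOTH members, EVERY place of `L⁺`,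
  EVERY `N ≥ 3` — in particular the END's `N = 3` (already odd) and every even rank.

What this does NOT give: anything about the rows' OWN carriers `𝓢.omegaLoc v`; non-line carriers; Lem. D.1 itself.  HC_CM is NOT proved.

Cell pub-hodgecm2 (COR-CM), audit class of the END rows `hD1''` ∕ `hD3`; seat prover-pub-hodgecm2-b10.

References: [Liu2021] Y. Liu, *Fourier–Jacobi cycles and arithmetic relative trace formula*, Camb. J. Math. 9 (2021) =
arXiv:2102.11518, App. D §D.1 (l. 5213–5221), Lemma D.1 (1) (l. 5229), (3) (l. 5233), Def. 4.11 (l. 2086); [Mok2014] C. P. Mok,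
Mem. AMS 235 (2015), §1 Notation p. 5; [NeukirchANT1999] J. Neukirch, *Algebraic Number Theory* (1999), Ch. II §3 Prop. (3.10), Ch. II §5
Prop. (5.3); [CasselsFrohlichANT1967] Ch. II §10.
-/

noncomputable section

open scoped Matrix MatrixGroups
open NumberField IsDedekindDomain
open Literature.RepresentationTheory
open Literature.RepresentationTheory.Liu2021 (OscillatorStandingData)
open Literature.RepresentationTheory.CentralCharacterQuotient (augmentation quotRep quotRep_mk)
open Literature.NumberTheory.GaloisRepresentations (HeckeCharacter)

namespace Literature.NumberTheory.Automorphic.Liu2021.LemD1IndexedNonVacuityChiAlone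

open UnitaryGroup

/-! ## §1 Local and global helpers -/

section Local

variable {E : Type} [Field E] [NumberField E] (w : HeightOneSpectrum (𝓞 E))

/-- **the unit-part homomorphism `E_wˣ → 𝒪_wˣ`, `x ↦ x · ϖ_w^{ord_w x}`**, the identity on `𝒪_wˣ` (copy of the private lemma of the
siblings). [cite: NeukirchANT1999, Ch. II §5 Prop. (5.3)] -/
private theorem exists_unitPart :
    ∃ υ : (w.adicCompletion E)ˣ →* (w.adicCompletionIntegers E).unitGroup,
      ∀ x : (w.adicCompletion E)ˣ, Valued.v (x : w.adicCompletion E) = 1 →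
        ((υ x : (w.adicCompletionIntegers E).unitGroup) : (w.adicCompletion E)ˣ) = x := by
  set ϖ : (w.adicCompletion E)ˣ := HeckeCharacter.uniformizer E w with hϖdef
  have hϖ : Valued.v (ϖ : w.adicCompletion E) = WithZero.exp (-1 : ℤ) := HeckeCharacter.valued_uniformizer w
  have hne : ∀ x : (w.adicCompletion E)ˣ, Valued.v (x : w.adicCompletion E) ≠ 0 := fun x =>
    (Valuation.ne_zero_iff _).2 x.ne_zero
  let f : (w.adicCompletion E)ˣ →* (w.adicCompletion E)ˣ :=
    { toFun := fun x => x * ϖ ^ WithZero.log (Valued.v (x : w.adicCompletion E))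
      map_one' := by rw [Units.val_one, map_one, WithZero.log_one, zpow_zero, one_mul]
      map_mul' := fun x y => by
        rw [Units.val_mul, map_mul, WithZero.log_mul (hne x) (hne y), zpow_add, mul_mul_mul_comm] }
  have hf : ∀ x, Valued.v ((f x : (w.adicCompletion E)ˣ) : w.adicCompletion E) = 1 := by
    intro x
    change Valued.v (((x * ϖ ^ WithZero.log (Valued.v (x : w.adicCompletion E)) : (w.adicCompletion E)ˣ)) :
      w.adicCompletion E) = 1
    obtain ⟨m, hm⟩ : ∃ m : ℤ, Valued.v (x : w.adicCompletion E) = WithZero.exp m :=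
      ⟨_, (WithZero.exp_log (hne x)).symm⟩
    rw [Units.val_mul, Units.val_zpow_eq_zpow_val, map_mul, map_zpow₀, hϖ, ← WithZero.exp_zsmul, smul_eq_mul,
      mul_neg, mul_one, hm, WithZero.log_exp, ← WithZero.exp_add, add_neg_cancel, WithZero.exp_zero]
  refine ⟨MonoidHom.codRestrict f _ fun x => (Valuation.mem_unitGroup_iff _ Valued.v (f x)).2 (hf x), fun x hx => ?_⟩
  rw [MonoidHom.codRestrict_apply]
  change x * ϖ ^ WithZero.log (Valued.v (x : w.adicCompletion E)) = x
  rw [hx, WithZero.log_one, zpow_zero, mul_one]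

/-- the «level set» `{y : v_w(y − 1) < v_w(s)}` is open in `E_w`. [cite: NeukirchANT1999, Ch. II §3, before Prop. (3.10)] -/
private theorem isOpen_setOf_valued_sub_one_lt (s : w.adicCompletion E) :
    IsOpen {y : w.adicCompletion E | Valued.v (y - 1) < Valued.v s} := by
  have h := (Valued.isOpen_ball (w.adicCompletion E) (Valued.v.restrict s)).preimage
    (show Continuous fun y : w.adicCompletion E => y - 1 from continuous_id.sub continuous_const)
  convert h using 1
  ext y
  simp only [Set.mem_setOf_eq, Set.mem_preimage, Valuation.restrict_lt_iff]

/-- `v_w(N) ≠ 0` and `v_w(N) ≤ 1` in `E_w` for a natural number `N ≠ 0` (characteristic `0`; ultrametric inequality). [folklore] -/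
private theorem valued_natCast_ne_zero_and_le_one {N : ℕ} (hN : N ≠ 0) :
    Valued.v ((N : w.adicCompletion E)) ≠ 0 ∧ Valued.v ((N : w.adicCompletion E)) ≤ 1 := by
  refine ⟨(Valuation.ne_zero_iff _).2 ?_, ?_⟩
  · have : ((N : w.adicCompletion E)) = algebraMap E (w.adicCompletion E) N := by rw [map_natCast]
    rw [this]
    exact (map_ne_zero_iff _ (algebraMap E (w.adicCompletion E)).injective).2 (Nat.cast_ne_zero.2 hN)
  · induction N with
    | zero => simp
    | succ k ih =>
      by_cases hk : k = 0
      · subst hk; simp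
      · rw [Nat.cast_succ]
        exact Valuation.map_add_le _ (ih hk) (by rw [Valuation.map_one])

/-- **`y^N ≠ 1` for a principal unit `y ≠ 1` with `v_w(y − 1) < v_w(N)`**: `y^N − 1 = (Σ_{i<N} y^i)(y − 1)` and
`Σ_{i<N} y^i = N + Σ_{i<N} (y^i − 1)` has valuation `v_w(N) ≠ 0` (`v_w(y^i − 1) ≤ v_w(y − 1) < v_w(N)`,
✔ `…InertConverse.valued_pow_sub_pow_le`). [cite: NeukirchANT1999, Ch. II §3 Prop. (3.10)] -/
theorem pow_sub_one_ne_zero_of_valued_sub_one_lt {N : ℕ} (hN : N ≠ 0) {y : w.adicCompletion E} (hy0 : Valued.v (y - 1) ≠ 0)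
    (hyN : Valued.v (y - 1) < Valued.v ((N : w.adicCompletion E))) : y ^ N - 1 ≠ 0 := by
  obtain ⟨hvN0, hvN1⟩ := valued_natCast_ne_zero_and_le_one w hN
  have hy1 : Valued.v y ≤ 1 := by
    have h := Valuation.map_one_add_of_lt Valued.v (hyN.trans_le hvN1)
    rw [add_sub_cancel] at h
    exact h.le
  -- `Σ_{i<N} y^i = N + Σ_{i<N} (y^i − 1)` has valuation `v(N)`
  have hsum : (∑ i ∈ Finset.range N, y ^ i) = (N : w.adicCompletion E) + ∑ i ∈ Finset.range N, (y ^ i - 1) := by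
    rw [Finset.sum_sub_distrib, Finset.sum_const, Finset.card_range, nsmul_eq_mul, mul_one]
    ring
  have hlt : Valued.v (∑ i ∈ Finset.range N, (y ^ i - 1)) < Valued.v ((N : w.adicCompletion E)) := by
    refine Valuation.map_sum_lt _ hvN0 fun i _ => ?_
    have h := LemD1IndexedNonVacuityInertConverse.valued_pow_sub_pow_le w hy1 (le_of_eq (Valuation.map_one _)) i
    rw [one_pow] at h
    exact h.trans_lt hyN
  have hS : Valued.v (∑ i ∈ Finset.range N, y ^ i) = Valued.v ((N : w.adicCompletion E)) := by
    rw [hsum]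
    exact Valuation.map_add_eq_of_lt_left _ hlt
  have hS0 : (∑ i ∈ Finset.range N, y ^ i) ≠ 0 := fun h => by
    rw [h, Valuation.map_zero] at hS
    exact hvN0 hS.symm
  have hy10 : y - 1 ≠ 0 := fun h => by
    rw [h, Valuation.map_zero] at hy0
    exact hy0 rfl
  rw [← geom_sum_mul]
  exact mul_ne_zero hS0 hy10

/-- **a LEVEL character of `E_wˣ` NOT killing a PRESCRIBED unit `t ≠ 1`** (any finite place `w`, `v_w(t) = 1`, `0 ≠ v_w(t − 1) =: γ`):
a homomorphism `θ : E_wˣ → ℂˣ` with OPEN KERNEL, of FINITE ORDER, unitary, trivial on the open subgroup `{x : v_w(x − 1) < γ}` and with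
`θ(t) ≠ 1`.  It is `φ ∘ (𝒪_wˣ → 𝒪_wˣ ∕ U_γ) ∘ (unit part)` for a character `φ` of the FINITE abelian group `𝒪_wˣ ∕ U_γ` (`𝒪_w`
compact, `U_γ` open) not killing the class of `t` (characters of a finite abelian group separate points).  ✔ `…LevelTwist.exists_level_character`
is the case `t = −1` (`γ = v_w(2)`). [cite: NeukirchANT1999, Ch. II §3 Prop. (3.10) and Ch. II §5 Prop. (5.3)] -/
theorem exists_character_apply_ne_one_of_level (t : (w.adicCompletion E)ˣ) (ht1 : Valued.v (t : w.adicCompletion E) = 1)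
    (ht0 : Valued.v ((t : w.adicCompletion E) - 1) ≠ 0) :
    ∃ θ : (w.adicCompletion E)ˣ →* ℂˣ,
      IsOpen (θ.ker : Set (w.adicCompletion E)ˣ) ∧ IsOfFinOrder θ ∧ (∀ x, ‖((θ x : ℂˣ) : ℂ)‖ = 1) ∧
      (∀ x : (w.adicCompletion E)ˣ,
        Valued.v ((x : w.adicCompletion E) - 1) < Valued.v ((t : w.adicCompletion E) - 1) → θ x = 1) ∧ θ t ≠ 1 := by
  classical
  set γ := Valued.v ((t : w.adicCompletion E) - 1) with hγ
  have hγle : γ ≤ 1 := by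
    rw [hγ]
    exact (Valuation.map_sub _ _ _).trans (by rw [ht1, Valuation.map_one, max_self])
  obtain ⟨υ, hυ⟩ := exists_unitPart w
  haveI : CompactSpace (w.adicCompletionIntegers E) :=
    Literature.NumberTheory.Automorphic.compactSpace_adicCompletionIntegers' E w
  set e : (w.adicCompletionIntegers E).unitGroup ≃* (w.adicCompletionIntegers E)ˣ :=
    (w.adicCompletionIntegers E).unitGroupMulEquiv with he
  have hecoe : ∀ a : (w.adicCompletionIntegers E).unitGroup,
      (((e a : (w.adicCompletionIntegers E)ˣ) : w.adicCompletionIntegers E) : w.adicCompletion E) =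
        ((a : (w.adicCompletion E)ˣ) : w.adicCompletion E) := fun a => by
    rw [he, ValuationSubring.coe_unitGroupMulEquiv_apply]
  have hle : ∀ u : (w.adicCompletionIntegers E)ˣ,
      Valued.v (((u : w.adicCompletionIntegers E)) : w.adicCompletion E) ≤ 1 := fun u =>
    (Valuation.mem_valuationSubring_iff _ _).1 (u : w.adicCompletionIntegers E).2
  -- the level subgroup `U_γ = {u : v(u - 1) < γ}` of `𝒪_wˣ`
  obtain ⟨H, hHmem⟩ : ∃ H : Subgroup (w.adicCompletionIntegers E)ˣ, ∀ u : (w.adicCompletionIntegers E)ˣ, u ∈ H ↔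
      Valued.v ((((u : w.adicCompletionIntegers E)) : w.adicCompletion E) - 1) < γ :=
    ⟨{ carrier := {u | Valued.v ((((u : w.adicCompletionIntegers E)) : w.adicCompletion E) - 1) < γ}
       mul_mem' := fun {a b} ha hb => by
         simp only [Set.mem_setOf_eq] at ha hb ⊢
         rw [Units.val_mul, MulMemClass.coe_mul]
         have hsplit : (((a : w.adicCompletionIntegers E)) : w.adicCompletion E) *
               (((b : w.adicCompletionIntegers E)) : w.adicCompletion E) - 1 =
             (((a : w.adicCompletionIntegers E)) : w.adicCompletion E) *
               ((((b : w.adicCompletionIntegers E)) : w.adicCompletion E) - 1) +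
               ((((a : w.adicCompletionIntegers E)) : w.adicCompletion E) - 1) := by ring
         rw [hsplit]
         refine (Valuation.map_add _ _ _).trans_lt (max_lt ?_ ha)
         rw [Valuation.map_mul]
         exact mul_lt_of_le_one_of_lt (hle a) hb
       one_mem' := by
         simp only [Set.mem_setOf_eq, Units.val_one, OneMemClass.coe_one, sub_self, Valuation.map_zero]
         exact zero_lt_iff.2 ht0
       inv_mem' := fun {a} ha => by
         simp only [Set.mem_setOf_eq] at ha ⊢
         have hinv : (((a⁻¹ : (w.adicCompletionIntegers E)ˣ) : w.adicCompletionIntegers E) : w.adicCompletion E) *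
             (((a : w.adicCompletionIntegers E)) : w.adicCompletion E) = 1 := by
           rw [← MulMemClass.coe_mul, ← Units.val_mul, inv_mul_cancel, Units.val_one, OneMemClass.coe_one]
         have hrw : (((a⁻¹ : (w.adicCompletionIntegers E)ˣ) : w.adicCompletionIntegers E) : w.adicCompletion E) - 1 =
             (((a⁻¹ : (w.adicCompletionIntegers E)ˣ) : w.adicCompletionIntegers E) : w.adicCompletion E) *
               (1 - (((a : w.adicCompletionIntegers E)) : w.adicCompletion E)) := by
           rw [mul_sub, mul_one, hinv]
         rw [hrw, Valuation.map_mul, Valuation.map_sub_swap]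
         exact mul_lt_of_le_one_of_lt (hle a⁻¹) ha }, fun u => Iff.rfl⟩
  have hHopen : IsOpen (H : Set (w.adicCompletionIntegers E)ˣ) := by
    have h := (isOpen_setOf_valued_sub_one_lt w ((t : w.adicCompletion E) - 1)).preimage
      (show Continuous fun u : (w.adicCompletionIntegers E)ˣ => (((u : w.adicCompletionIntegers E)) : w.adicCompletion E) from
        continuous_subtype_val.comp Units.continuous_val)
    convert h using 1
    ext u
    rw [SetLike.mem_coe, hHmem, Set.mem_preimage, Set.mem_setOf_eq]
  haveI : Finite ((w.adicCompletionIntegers E)ˣ ⧸ H) := Subgroup.quotient_finite_of_isOpen H hHopen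
  -- `t ∉ U_γ`
  have hmk : (QuotientGroup.mk (e (υ t)) : (w.adicCompletionIntegers E)ˣ ⧸ H) ≠ 1 := by
    rw [Ne, QuotientGroup.eq_one_iff, hHmem, hecoe, hυ t ht1]
    exact lt_irrefl _
  -- characters of a finite abelian group separate points (abstract statement, instantiated on the quotient)
  have key : ∀ (G : Type) [CommGroup G] [Finite G] (a : G), a ≠ 1 →
      ∃ φ : G →* ℂˣ, φ a ≠ 1 ∧ ∃ n : ℕ, 0 < n ∧ ∀ g, φ g ^ n = 1 := fun G _ _ a ha => by
    obtain ⟨φ, hφ⟩ := CommGroup.exists_apply_ne_one_of_hasEnoughRootsOfUnity G ℂ ha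
    exact ⟨φ, hφ, Nat.card G, Nat.card_pos, fun g => by rw [← map_pow, pow_card_eq_one', map_one]⟩
  obtain ⟨φ, hφ, n, hn0, hφpow⟩ := key _ _ hmk
  have hφnorm : ∀ g, ‖((φ g : ℂˣ) : ℂ)‖ = 1 := fun g => by
    have h1 : ‖((φ g : ℂˣ) : ℂ)‖ ^ n = 1 := by
      rw [← norm_pow, ← Units.val_pow_eq_pow_val, hφpow, Units.val_one, norm_one]
    exact (pow_eq_one_iff_of_nonneg (norm_nonneg _) hn0.ne').1 h1
  let θ : (w.adicCompletion E)ˣ →* ℂˣ := φ.comp ((QuotientGroup.mk' H).comp (e.toMonoidHom.comp υ))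
  have hθ : ∀ x, θ x = φ (QuotientGroup.mk (e (υ x))) := fun x => rfl
  -- the character is trivial on `U_γ`
  have hlevel : ∀ x : (w.adicCompletion E)ˣ, Valued.v ((x : w.adicCompletion E) - 1) < γ → θ x = 1 := by
    intro x hx
    have hvx : Valued.v (x : w.adicCompletion E) = 1 := by
      have := Valuation.map_one_add_of_lt Valued.v (hx.trans_le hγle)
      rwa [add_sub_cancel] at this
    have hmem : e (υ x) ∈ H := by
      rw [hHmem, hecoe, hυ x hvx]
      exact hx
    rw [hθ, (QuotientGroup.eq_one_iff _).2 hmem, map_one]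
  refine ⟨θ, ?_, ?_, fun x => by rw [hθ]; exact hφnorm _, hlevel, by rw [hθ]; exact hφ⟩
  · -- open kernel
    refine Subgroup.isOpen_of_mem_nhds _ (g := 1) ?_
    have hU : {y : w.adicCompletion E | Valued.v (y - 1) < γ} ∈ nhds (1 : w.adicCompletion E) :=
      (isOpen_setOf_valued_sub_one_lt w ((t : w.adicCompletion E) - 1)).mem_nhds (by
        rw [Set.mem_setOf_eq, sub_self, Valuation.map_zero]; exact zero_lt_iff.2 ht0)
    have hU' : (Units.val ⁻¹' {y : w.adicCompletion E | Valued.v (y - 1) < γ}) ∈ nhds (1 : (w.adicCompletion E)ˣ) :=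
      Units.continuous_val.continuousAt.preimage_mem_nhds (by rw [Units.val_one]; exact hU)
    exact Filter.mem_of_superset hU' fun x hx => hlevel x hx
  · -- finite order
    refine isOfFinOrder_iff_pow_eq_one.2 ⟨n, hn0, MonoidHom.ext fun x => ?_⟩
    rw [MonoidHom.pow_apply, MonoidHom.one_apply, hθ, hφpow]

/-- A homomorphism with open kernel is locally constant (copy of the tree's private lemma). [folklore] -/
private theorem isLocallyConstant_of_isOpen_ker {Γ G : Type*} [Group Γ] [TopologicalSpace Γ]
    [ContinuousMul Γ] [Group G] (r : Γ →* G) (h : IsOpen (r.ker : Set Γ)) :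
    IsLocallyConstant r := by
  refine (IsLocallyConstant.iff_exists_open r).2 fun σ => ⟨{τ | σ⁻¹ * τ ∈ r.ker}, ?_, ?_, ?_⟩
  · exact h.preimage (continuous_const_mul σ⁻¹)
  · show σ⁻¹ * σ ∈ r.ker
    rw [inv_mul_cancel]; exact r.ker.one_mem
  · intro τ hτ
    have hτ' : r (σ⁻¹ * τ) = 1 := hτ
    rw [map_mul, map_inv, inv_mul_eq_one] at hτ'
    exact hτ'.symm

end Local

/-! ## §2 The place model: a det-line character `Λ = θ ∘ pr_w ∘ det` with PRESCRIBED NON-TRIVIAL central character — any place, any `N ≥ 2` -/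

section PlaceModel

variable {F : Type} (E : Type) [Field F] [NumberField F] [Field E] [NumberField E] [Algebra F E]
  [Algebra.IsQuadraticExtension F E] (v : HeightOneSpectrum (𝓞 F)) (c : E ≃ₐ[F] E)
  {δ : E} (hcδ : c δ = -δ) (hδ : δ ≠ 0)
  (N : ℕ) (J : Matrix (Fin N) (Fin N) E) (hN : 2 ≤ N) (hJh : (J.map c)ᵀ = J) (hJdet : J.det ≠ 0)

omit [Algebra.IsQuadraticExtension F E] in
include hcδ hδ in
/-- **a GLOBAL norm-one principal unit BELOW ANY THRESHOLD** at a place `w ∣ v`: for every `τ ≠ 0` in the value group there is `a ∈ E`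
with `a · c(a) = 1`, `v_w(a − 1) ≠ 0`, `v_w(a − 1) < τ` and `v_w(a − 1) < 1` — `a = (1 + u)/(1 − u)`, `u = δ · π^k` with `k` large
(✔ `…WildCarrier.exists_mul_conj_eq_one_valuation_sub_one_lt` is `τ = 1`; same proof, larger `k`). [cite: CasselsFrohlichANT1967, Ch. II §10] -/
theorem exists_mul_conj_eq_one_valuation_sub_one_lt_of_ne_zero (w : PlacesOver E v) {τ : WithZero (Multiplicative ℤ)} (hτ : τ ≠ 0) :
    ∃ a : E, a * c a = 1 ∧ w.1.valuation E (a - 1) ≠ 0 ∧ w.1.valuation E (a - 1) < τ ∧ w.1.valuation E (a - 1) < 1 := by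
  classical
  -- a non-zero `π ∈ 𝔭_v`, of `w`-valuation `< 1`
  obtain ⟨π, hπv, hπ0⟩ := Submodule.exists_mem_ne_zero_of_ne_bot v.ne_bot
  haveI := PlacesOver.liesOver (E := E) w
  set p : E := algebraMap F E (algebraMap (𝓞 F) F π) with hp
  have hp' : p = algebraMap (𝓞 E) E (algebraMap (𝓞 F) (𝓞 E) π) := by
    rw [hp, ← IsScalarTower.algebraMap_apply, ← IsScalarTower.algebraMap_apply]
  have hp1 : w.1.valuation E p < 1 := by
    rw [hp', HeightOneSpectrum.valuation_lt_one_iff_mem]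
    have : π ∈ (w.1.asIdeal.under (𝓞 F)) := by
      rw [← Ideal.LiesOver.over (p := v.asIdeal) (P := w.1.asIdeal)]
      exact hπv
    exact Ideal.mem_comap.1 this
  have hp0 : p ≠ 0 := by
    rw [hp]
    exact (map_ne_zero _).2 ((map_ne_zero_iff _ (IsFractionRing.injective (𝓞 F) F)).2 hπ0)
  have hcp : c p = p := by rw [hp, AlgEquiv.commutes]
  -- `v_w(δ) = exp m`, `v_w(p) = exp n` with `n < 0`, `τ = exp m₀`; `u = δ p^k` with `k = (m − m₀).toNat + m.toNat + 1`
  have hvδ0 : w.1.valuation E δ ≠ 0 := (Valuation.ne_zero_iff _).2 hδ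
  obtain ⟨m, hm⟩ : ∃ m : ℤ, w.1.valuation E δ = WithZero.exp m := ⟨_, (WithZero.exp_log hvδ0).symm⟩
  have hvp0 : w.1.valuation E p ≠ 0 := (Valuation.ne_zero_iff _).2 hp0
  obtain ⟨n, hn⟩ : ∃ n : ℤ, w.1.valuation E p = WithZero.exp n := ⟨_, (WithZero.exp_log hvp0).symm⟩
  have hn0 : n < 0 := by
    rw [hn, ← WithZero.exp_zero, WithZero.exp_lt_exp] at hp1
    exact hp1
  obtain ⟨m₀, hm₀⟩ : ∃ m₀ : ℤ, τ = WithZero.exp m₀ := ⟨_, (WithZero.exp_log hτ).symm⟩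
  set k : ℕ := (m - m₀).toNat + m.toNat + 1 with hk
  set u : E := δ * p ^ k with hu
  have hcu : c u = -u := by rw [hu, map_mul, map_pow, hcδ, hcp, neg_mul]
  have hu0 : u ≠ 0 := mul_ne_zero hδ (pow_ne_zero _ hp0)
  have hk1 : (k : ℤ) = ((m - m₀).toNat : ℤ) + (m.toNat : ℤ) + 1 := by rw [hk]; push_cast; ring
  have hle1 : m - m₀ ≤ ((m - m₀).toNat : ℤ) := Int.self_le_toNat (m - m₀)
  have hle2 : m ≤ (m.toNat : ℤ) := Int.self_le_toNat m
  have hkn : (k : ℤ) * n ≤ -(k : ℤ) := by nlinarith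
  have hu1 : w.1.valuation E u < 1 := by
    rw [hu, map_mul, map_pow, hm, hn, ← WithZero.exp_nsmul, ← WithZero.exp_add, ← WithZero.exp_zero, WithZero.exp_lt_exp,
      nsmul_eq_mul]
    omega
  have huτ : w.1.valuation E u < τ := by
    rw [hu, map_mul, map_pow, hm, hn, ← WithZero.exp_nsmul, ← WithZero.exp_add, hm₀, WithZero.exp_lt_exp, nsmul_eq_mul]
    omega
  -- `a = (1 + u)/(1 − u)`
  have h1u : w.1.valuation E (1 - u) = 1 := Valuation.map_one_sub_of_lt _ hu1
  have h1u' : w.1.valuation E (1 + u) = 1 := Valuation.map_one_add_of_lt _ hu1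
  have hne1 : (1 - u : E) ≠ 0 := fun h => by rw [h, map_zero] at h1u; exact zero_ne_one h1u
  have hne1' : (1 + u : E) ≠ 0 := fun h => by rw [h, map_zero] at h1u'; exact zero_ne_one h1u'
  have h2 : w.1.valuation E 2 ≤ 1 := by
    rw [show (2 : E) = 1 + 1 by norm_num]
    exact Valuation.map_add_le _ (by rw [Valuation.map_one]) (by rw [Valuation.map_one])
  have hrw : (1 + u) * (1 - u)⁻¹ - 1 = (2 * u) * (1 - u)⁻¹ := by field_simp; ring
  refine ⟨(1 + u) * (1 - u)⁻¹, ?_, ?_, ?_, ?_⟩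
  · rw [map_mul, map_inv₀, map_add, map_sub, map_one, hcu, sub_neg_eq_add, ← sub_eq_add_neg]
    field_simp
  · rw [hrw, map_mul, map_inv₀, h1u, inv_one, mul_one, map_mul]
    exact mul_ne_zero ((Valuation.ne_zero_iff _).2 two_ne_zero) ((Valuation.ne_zero_iff _).2 hu0)
  · rw [hrw, map_mul, map_inv₀, h1u, inv_one, mul_one, map_mul]
    exact mul_lt_of_le_one_of_lt h2 huτ
  · rw [hrw, map_mul, map_inv₀, h1u, inv_one, mul_one, map_mul]
    exact mul_lt_of_le_one_of_lt h2 hu1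

include hcδ in
/-- **a det-line character with PRESCRIBED NON-TRIVIAL central character** — at ANY place `w ∣ v`, for ANY `N ≥ 2`: there are a character
`Λ = θ ∘ pr_w ∘ det` of `U(V)(F_v) = S.U` and a Step-3 character `χ_Λ ∈ ChiSet S`, `χ_Λ(z) = θ(z_w^N) = θ(z_w)^N`, with `Λ ∘ S.scalar = χ_Λ`
(`det(z · 1_N) = z^N`), `Λ = 1` on an open neighbourhood of `1`, `Λ(g₀) ≠ 1` for some `g₀ ∈ S.U`, AND `χ_Λ(ι(a)) ≠ 1` at a global norm-one
principal unit `a` — the level character `θ` of §1 is chosen NOT to kill `t = a_w^N`, which is `≠ 1` because `v_w(a − 1) < v_w(N)`.  Whatever the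
parity of `N` (✔ `…LevelCarrier.exists_level_carrier_character` separated the centre only through `χ_Λ(−1) = θ_w(−1)^N`, i.e. for `N` odd).
[cite: Liu2021, App. D §D.1 Step 3 (l. 5221)] [cite: Mok2014, §1 Notation p. 5] [cite: NeukirchANT1999, Ch. II §3 Prop. (3.10)] -/
theorem exists_carrier_character_central_ne_one (w : PlacesOver E v) :
    ∃ (Λ : (LemD1OfPlace.standingData E v c N J hcδ hδ hN hJh hJdet).U →* ℂˣ)
      (χ : LemD1.ChiSet (LemD1OfPlace.standingData E v c N J hcδ hδ hN hJh hJdet)),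
      (∀ z : (LemD1OfPlace.standingData E v c N J hcδ hδ hN hJh hJdet).normOne,
        Λ ((LemD1OfPlace.standingData E v c N J hcδ hδ hN hJh hJdet).scalar z) = χ.1 z) ∧
      (∃ O : Set (LemD1OfPlace.standingData E v c N J hcδ hδ hN hJh hJdet).U, IsOpen O ∧ 1 ∈ O ∧ ∀ g ∈ O, Λ g = 1) ∧
      (∃ g₀ : (LemD1OfPlace.standingData E v c N J hcδ hδ hN hJh hJdet).U, Λ g₀ ≠ 1) ∧
      (∃ z₀ : (LemD1OfPlace.standingData E v c N J hcδ hδ hN hJh hJdet).normOne, χ.1 z₀ ≠ 1) := by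
  have hN0 : N ≠ 0 := by omega
  let S := LemD1OfPlace.standingData E v c N J hcδ hδ hN hJh hJdet
  obtain ⟨hvN0, hvN1⟩ := valued_natCast_ne_zero_and_le_one w.1 hN0
  -- a global norm-one principal unit with `v_w(a − 1) < v_w(N)`
  have hτ : w.1.valuation E (N : E) ≠ 0 := (Valuation.ne_zero_iff _).2 (Nat.cast_ne_zero.2 hN0)
  obtain ⟨a, hac, ha0, haτ, -⟩ := exists_mul_conj_eq_one_valuation_sub_one_lt_of_ne_zero E v c hcδ hδ w hτ
  have hcoeN : Valued.v ((N : w.1.adicCompletion E)) = w.1.valuation E (N : E) := by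
    have : ((N : w.1.adicCompletion E)) = ((N : E) : w.1.adicCompletion E) := by
      change ((N : w.1.adicCompletion E)) = algebraMap E (w.1.adicCompletion E) (N : E)
      rw [map_natCast]
    rw [this, HeightOneSpectrum.valuedAdicCompletion_eq_valuation']
  let prw : (LocalRing E v)ˣ →* (w.1.adicCompletion E)ˣ :=
    Units.map (Pi.evalRingHom (fun w' : PlacesOver E v => w'.1.adicCompletion E) w).toMonoidHom
  have hprw : ∀ y : (LocalRing E v)ˣ, ((prw y : (w.1.adicCompletion E)ˣ) : w.1.adicCompletion E) = (y : LocalRing E v) w :=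
    fun y => rfl
  have hu : IsUnit (algebraMap E (LocalRing E v) a) :=
    IsUnit.of_mul_eq_one (algebraMap E (LocalRing E v) (c a)) (by rw [← map_mul, hac, map_one])
  have hzn : hu.unit ∈ S.normOne := by
    rw [OscillatorStandingData.mem_normOne_iff', LemD1OfPlace.standingData_conj_apply, IsUnit.unit_spec, conjLocal_algebraMap,
      ← map_mul, hac, map_one]
  have hcoe : ((prw hu.unit : (w.1.adicCompletion E)ˣ) : w.1.adicCompletion E) = ((a : E) : w.1.adicCompletion E) := by
    rw [hprw, IsUnit.unit_spec]; rfl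
  have hval : Valued.v (((a : E) : w.1.adicCompletion E) - 1) = w.1.valuation E (a - 1) := by
    have : ((a : E) : w.1.adicCompletion E) - 1 = ((a - 1 : E) : w.1.adicCompletion E) := by
      change algebraMap E (w.1.adicCompletion E) a - 1 = algebraMap E (w.1.adicCompletion E) (a - 1)
      rw [map_sub, map_one]
    rw [this, HeightOneSpectrum.valuedAdicCompletion_eq_valuation']
  have hy0 : Valued.v (((a : E) : w.1.adicCompletion E) - 1) ≠ 0 := by rw [hval]; exact ha0
  have hyN : Valued.v (((a : E) : w.1.adicCompletion E) - 1) < Valued.v ((N : w.1.adicCompletion E)) := by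
    rw [hval, hcoeN]; exact haτ
  have ha1 : Valued.v ((a : E) : w.1.adicCompletion E) = 1 := by
    have h := Valuation.map_one_add_of_lt Valued.v (hyN.trans_le hvN1)
    rwa [add_sub_cancel] at h
  -- `t = a_w^N ≠ 1`
  have ht1 : Valued.v (((prw hu.unit ^ N : (w.1.adicCompletion E)ˣ)) : w.1.adicCompletion E) = 1 := by
    rw [Units.val_pow_eq_pow_val, hcoe, Valuation.map_pow, ha1, one_pow]
  have ht0 : Valued.v ((((prw hu.unit ^ N : (w.1.adicCompletion E)ˣ)) : w.1.adicCompletion E) - 1) ≠ 0 := by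
    rw [Units.val_pow_eq_pow_val, hcoe]
    exact (Valuation.ne_zero_iff _).2 (pow_sub_one_ne_zero_of_valued_sub_one_lt w.1 hN0 hy0 hyN)
  obtain ⟨θ, hθopen, -, hθnorm, hθlevel, hθt⟩ := exists_character_apply_ne_one_of_level w.1 (prw hu.unit ^ N) ht1 ht0
  -- `Λ = θ ∘ pr_w ∘ det`, `χ_Λ = (θ ∘ pr_w)^N` on `E_v¹`
  have hθc : Continuous fun x : (LocalRing E v)ˣ => ((θ (prw x) : ℂˣ) : ℂ) :=
    (Units.continuous_val.comp (isLocallyConstant_of_isOpen_ker θ hθopen).continuous).comp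
      (Continuous.units_map _ (continuous_apply w))
  let detU : S.U →* (LocalRing E v)ˣ := Matrix.GeneralLinearGroup.det.comp S.U.subtype
  let Λ : S.U →* ℂˣ := θ.comp (prw.comp detU)
  have hΛ : ∀ g : S.U, Λ g = θ (prw (Matrix.GeneralLinearGroup.det (g : GL (Fin N) (LocalRing E v)))) := fun g => rfl
  let χ₀ : S.normOne →* ℂˣ := (θ.comp (prw.comp S.normOne.subtype)) ^ N
  have hχ₀ : ∀ z : S.normOne, χ₀ z = θ (prw (z : (LocalRing E v)ˣ)) ^ N := fun z => rfl
  let χ : LemD1.ChiSet S := ⟨χ₀, fun z => by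
      rw [hχ₀, Units.val_pow_eq_pow_val, norm_pow, hθnorm, one_pow],
    by
      have : (fun z : S.normOne => ((χ₀ z : ℂˣ) : ℂ)) =
          fun z : S.normOne => (((θ (prw (z : (LocalRing E v)ˣ)) : ℂˣ) : ℂ)) ^ N := by
        funext z; rw [hχ₀, Units.val_pow_eq_pow_val]
      rw [this]
      exact (hθc.comp continuous_subtype_val).pow N⟩
  have hdet : ∀ z : S.normOne, Matrix.GeneralLinearGroup.det ((S.scalar z : S.U) : GL (Fin N) (LocalRing E v)) =
      (z : (LocalRing E v)ˣ) ^ N := fun z => by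
    apply Units.ext
    rw [Matrix.GeneralLinearGroup.val_det_apply, OscillatorStandingData.coe_scalar, Matrix.scalar_apply, Matrix.det_diagonal,
      Finset.prod_const, Finset.card_univ, Fintype.card_fin, Units.val_pow_eq_pow_val]
  have hcen : ∀ z : S.normOne, Λ (S.scalar z) = χ.1 z := fun z => by
    change Λ (S.scalar z) = χ₀ z
    rw [hΛ, hdet, map_pow, map_pow, hχ₀]
  refine ⟨Λ, χ, hcen, ?_, ?_, ⟨⟨hu.unit, hzn⟩, ?_⟩⟩
  · -- the open neighbourhood `{g : v_w(det(g)_w − 1) < v_w(t − 1)}` of `1`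
    let f : S.U → w.1.adicCompletion E := fun g =>
      (((g : GL (Fin N) (LocalRing E v)) : Matrix (Fin N) (Fin N) (LocalRing E v)).map
        (Pi.evalRingHom (fun w' : PlacesOver E v => w'.1.adicCompletion E) w)).det
    have hf : ∀ g : S.U, f g = ((prw (Matrix.GeneralLinearGroup.det (g : GL (Fin N) (LocalRing E v))) :
        (w.1.adicCompletion E)ˣ) : w.1.adicCompletion E) := fun g => by
      rw [hprw, Matrix.GeneralLinearGroup.val_det_apply]
      change _ = (Pi.evalRingHom (fun w' : PlacesOver E v => w'.1.adicCompletion E) w)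
        (((g : GL (Fin N) (LocalRing E v)) : Matrix (Fin N) (Fin N) (LocalRing E v)).det)
      rw [RingHom.map_det]
      rfl
    have hfc : Continuous f := by
      refine Continuous.matrix_det ?_
      refine Continuous.matrix_map ?_ (continuous_apply w)
      exact Units.continuous_val.comp continuous_subtype_val
    refine ⟨f ⁻¹' {y | Valued.v (y - 1) < Valued.v ((((prw hu.unit ^ N : (w.1.adicCompletion E)ˣ)) : w.1.adicCompletion E) - 1)},
      (isOpen_setOf_valued_sub_one_lt w.1 _).preimage hfc, ?_, fun g hg => ?_⟩
    · rw [Set.mem_preimage, Set.mem_setOf_eq, hf, OneMemClass.coe_one, map_one, map_one, Units.val_one, sub_self, map_zero]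
      exact zero_lt_iff.2 ht0
    · rw [Set.mem_preimage, Set.mem_setOf_eq, hf] at hg
      rw [hΛ]
      exact hθlevel _ hg
  · -- `Λ(g₀) = θ(a_w) ≠ 1` at an element of determinant `ι(a)` (else `θ(t) = θ(a_w)^N = 1`)
    obtain ⟨g₀, hg₀⟩ := LemD1IndexedNonVacuityDetCarrier.exists_mem_U_det_eq E v c hcδ hδ N J hN hJh hJdet ⟨hu.unit, hzn⟩
    refine ⟨g₀, fun h => hθt ?_⟩
    rw [hΛ, hg₀] at h
    change θ (prw hu.unit) = 1 at h
    rw [map_pow, h, one_pow]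
  · -- `χ_Λ(ι(a)) = θ(a_w)^N = θ(t) ≠ 1`
    change χ₀ _ ≠ 1
    rw [hχ₀, ← map_pow]
    exact hθt

/-! ## §3 The JOINT certificate «(1) ∧ (3)» with the `χ`-conjunct ALONE separating — EVERY `N ≥ 3`, EVERY place -/

/-- For a datum whose carrier is the line `ℂ` with `U(V)(F)` acting through a character `λ` that agrees with `χ` on the centre,
the `χ`-augmentation submodule vanishes (copy of the siblings' private lemma). [folklore] -/
private theorem augmentation_eq_bot_of_character {F₀ E₀ : Type} [Field F₀] [ValuativeRel F₀] [TopologicalSpace F₀]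
    [CommRing E₀] [Algebra F₀ E₀] [TopologicalSpace E₀] {n : ℕ} (L : LemD1Data F₀ E₀ n ℂ) (lam : L.S.U →* ℂˣ)
    (hω : ∀ (g : L.S.U) (x : ℂ), L.omega g x = (lam g : ℂ) * x)
    (hcen : ∀ z : L.S.normOne, lam (L.S.scalar z) = L.chi z) :
    augmentation L.omega L.S.scalar L.chi = ⊥ := by
  unfold augmentation
  refine iSup_eq_bot.2 fun z => ?_
  rw [LinearMap.range_eq_bot]
  ext
  simp [hω, hcen]

/-- Two lines on which a group acts through characters `λ₁` and `λ₀` with `λ₁ g₀ ≠ λ₀ g₀` for some `g₀` have NON-isomorphic maximal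
`χ`-quotients (the first quotient being the line itself).  Copy of the siblings' private lemma. [folklore] -/
private theorem not_areIsomorphicRep_quotRep_of_characters {G Z : Type*} [Group G] [Group Z]
    (ρ₁ ρ₀ : Representation ℂ G ℂ) {ζ : Z →* G} (hζ : ∀ z, ζ z ∈ Subgroup.center G) (χ₁ χ₀ : Z →* ℂˣ)
    (lam₁ lam₀ : G →* ℂˣ) (h₁ : ∀ (g : G) (x : ℂ), ρ₁ g x = (lam₁ g : ℂ) * x) (h₀ : ∀ (g : G) (x : ℂ), ρ₀ g x = (lam₀ g : ℂ) * x)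
    (hN₁ : augmentation ρ₁ ζ χ₁ = ⊥) {g₀ : G} (hg₀ : lam₁ g₀ ≠ lam₀ g₀) :
    ¬ AreIsomorphicRep (quotRep ρ₁ hζ χ₁) (quotRep ρ₀ hζ χ₀) := by
  rintro ⟨f, hf⟩
  have hw0 : (Submodule.Quotient.mk 1 : ℂ ⧸ augmentation ρ₁ ζ χ₁) ≠ 0 := by
    rw [Ne, Submodule.Quotient.mk_eq_zero, hN₁, Submodule.mem_bot]
    exact one_ne_zero
  have h1 : quotRep ρ₁ hζ χ₁ g₀ (Submodule.Quotient.mk 1) =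
      (lam₁ g₀ : ℂ) • (Submodule.Quotient.mk 1 : ℂ ⧸ augmentation ρ₁ ζ χ₁) := by
    rw [quotRep_mk, h₁, ← smul_eq_mul, Submodule.Quotient.mk_smul]
  have h2 : ∀ y : ℂ ⧸ augmentation ρ₀ ζ χ₀, quotRep ρ₀ hζ χ₀ g₀ y = (lam₀ g₀ : ℂ) • y := by
    intro y
    obtain ⟨u, rfl⟩ := Submodule.Quotient.mk_surjective _ y
    rw [quotRep_mk, h₀, ← smul_eq_mul, Submodule.Quotient.mk_smul]
  have key := hf g₀ (Submodule.Quotient.mk 1)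
  rw [h1, h2, map_smul] at key
  have hsub : ((lam₁ g₀ : ℂ) - lam₀ g₀) • f (Submodule.Quotient.mk 1) = 0 := by
    rw [sub_smul, key, sub_self]
  rcases smul_eq_zero.1 hsub with h | h
  · exact hg₀ (Units.ext (sub_eq_zero.1 h))
  · exact hw0 (f.injective (by rw [h, map_zero]))

/-- **Item (1) AS PRINTED holds at a character datum of rank `n ≠ 2`** (copy of the siblings' private lemma).
[cite: Liu2021, App. D Lemma D.1 (1) (l. 5229)] -/
private theorem lemD1_1AsPrinted_of_character_of_rank_ne_two' {F₀ E₀ : Type} [Field F₀] [ValuativeRel F₀]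
    [TopologicalSpace F₀] [CommRing E₀] [Algebra F₀ E₀] [TopologicalSpace E₀] [IsTopologicalRing E₀] {n₀ : ℕ}
    (L : LemD1Data F₀ E₀ n₀ ℂ) (lam : L.S.U →* ℂˣ) (hω : ∀ (g : L.S.U) (x : ℂ), L.omega g x = (lam g : ℂ) * x)
    (hcen : ∀ z : L.S.normOne, lam (L.S.scalar z) = L.chi z)
    (hopen : ∃ O : Set L.S.U, IsOpen O ∧ (1 : L.S.U) ∈ O ∧ ∀ g ∈ O, lam g = 1) (hn : n₀ ≠ 2) :
    LemD1_1AsPrinted L := by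
  have hN : augmentation L.omega L.S.scalar L.chi = ⊥ := augmentation_eq_bot_of_character L lam hω hcen
  have hfin : Module.finrank ℂ (ℂ ⧸ augmentation L.omega L.S.scalar L.chi) = 1 := by
    rw [(Submodule.quotEquivOfEqBot _ hN).finrank_eq, Module.finrank_self]
  haveI hsimple : IsSimpleModule ℂ (ℂ ⧸ augmentation L.omega L.S.scalar L.chi) :=
    isSimpleModule_iff_finrank_eq_one.2 hfin
  have hact : ∀ (g : L.S.U) (w : ℂ ⧸ augmentation L.omega L.S.scalar L.chi),
      L.datum.quot g w = (lam g : ℂ) • w := by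
    intro g w
    obtain ⟨y, rfl⟩ := Submodule.Quotient.mk_surjective _ w
    rw [LemD1Data.datum_quot, quotRep_mk, hω, ← smul_eq_mul, Submodule.Quotient.mk_smul]
  refine ⟨⟨?_, ?_, ?_⟩, ?_⟩
  · intro W
    rcases eq_bot_or_eq_top W.toSubmodule with h | h
    · exact Or.inl (Subrepresentation.toSubmodule_injective h)
    · exact Or.inr (Subrepresentation.toSubmodule_injective h)
  · intro x
    obtain ⟨O, hO, h1O, hlam⟩ := hopen
    change IsOpen (L.datum.quot.stabilizerSubgroup x : Set L.S.U)
    refine Subgroup.isOpen_of_mem_nhds _ (g := 1) (Filter.mem_of_superset (hO.mem_nhds h1O) fun g hg => ?_)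
    change L.datum.quot g x = x
    rw [hact, hlam g hg, Units.val_one, one_smul]
  · intro K _
    infer_instance
  · refine iff_of_false ?_ ?_
    · rw [not_subsingleton_iff_nontrivial]
      exact Module.nontrivial_of_finrank_pos (R := ℂ) (by rw [hfin]; exact one_pos)
    · exact fun h => hn h.2.1.2

include hcδ in
/-- **(1) ∧ (3) JOINTLY, the `χ`-conjunct deciding ALONE — EVERY `N ≥ 3`, EVERY place `w ∣ v`** (split, inert or ramified; above `2`,
above a prime dividing `N`, or not; `N` EVEN included): for every Step-2 element `μ` and every representative `e`, the two-member collection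
with labels `(μ, e, 1)`, `(μ, e, χ_Λ)` — SAME `μ`, SAME `ε`, `χ_Λ ≠ 1` the central character of §2 — and carriers the trivial line and the
line of `Λ` satisfies [Lem. D.1, first sentence + (1)] AS PRINTED member by member AND [Lem. D.1 (3)] AS PRINTED for all four pairs; the
`ω`'s are NON-isomorphic (`Λ(g₀) ≠ 1`) and exactly the `χ`-slot separates the labels.  ✔ `…LevelCarrier.exists_lemD1IndexedFamily_item1_and_lemD1_3_chi`
needed `N` odd. [cite: Liu2021, App. D Lemma D.1 (1) and (3) (l. 5229, 5233)] -/
theorem exists_lemD1IndexedFamily_item1_and_lemD1_3_chi (w : PlacesOver E v) (h3 : 3 ≤ N)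
    (μ : LemD1.MuSet (LemD1OfPlace.standingData E v c N J hcδ hδ hN hJh hJdet))
    (e : LemD1.EpsRep (LemD1OfPlace.standingData E v c N J hcδ hδ hN hJh hJdet)) :
    ∃ Lf : LemD1IndexedFamily (v.adicCompletion F) (LocalRing E v) N (Fin 2),
      Lf.S = LemD1OfPlace.standingData E v c N J hcδ hδ hN hJh hJdet ∧
      (∀ i, (Lf.eps i).1 = e.1) ∧ (∀ i, (Lf.mu i).1 = μ.1) ∧ (Lf.chi 0).1 = 1 ∧
      Lf.Item1AsPrinted ∧ LemD1_3AsPrintedI Lf ∧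
      Lf.mu 0 = Lf.mu 1 ∧ LemD1.SameClass (Lf.eps 0) (Lf.eps 1) ∧ Lf.chi 0 ≠ Lf.chi 1 ∧
      ¬ AreIsomorphicRep (Lf.quot 1) (Lf.quot 0) := by
  classical
  obtain ⟨e₁, he₁⟩ := e
  have hN2 : N ≠ 2 := by omega
  obtain ⟨Λ, χ₁, hcen, hopen, ⟨g₀, hΛg₀⟩, ⟨z₀, hz₀⟩⟩ := exists_carrier_character_central_ne_one E v c hcδ hδ N J hN hJh hJdet w
  let S := LemD1OfPlace.standingData E v c N J hcδ hδ hN hJh hJdet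
  let χ₀ : LemD1.ChiSet S := ⟨1, fun z => by simp, by simpa using continuous_const⟩
  let ω₀ : Representation ℂ S.U ℂ := Representation.trivial ℂ S.U ℂ
  let ω₁ : Representation ℂ S.U ℂ := (DistribMulAction.toModuleEnd ℂ ℂ).comp Λ
  have hω₀ : ∀ (g : S.U) (x : ℂ), ω₀ g x = ((1 : S.U →* ℂˣ) g : ℂ) * x := fun g x => by
    rw [MonoidHom.one_apply, Units.val_one, one_mul]; rfl
  have hω₁ : ∀ (g : S.U) (x : ℂ), ω₁ g x = (Λ g : ℂ) * x := fun g x => by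
    change (Λ g : ℂˣ) • x = _
    rw [Units.smul_def, smul_eq_mul]
  let Lf : LemD1IndexedFamily (v.adicCompletion F) (LocalRing E v) N (Fin 2) :=
    { isNonarchimedeanLocalField := inferInstance
      isModuleTopology := LemD1OfPlace.isModuleTopology_localRing E v
      S := S
      mu := fun _ => μ
      eps := fun _ => ⟨e₁, he₁⟩
      chi := ![χ₀, χ₁]
      V := fun _ => ℂ
      omega := ![ω₀, ω₁] }
  have hχne : Lf.chi 0 ≠ Lf.chi 1 := fun h => by
    have h' := congrArg (fun χ : LemD1.ChiSet S => χ.1 z₀) h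
    change (1 : S.normOne →* ℂˣ) z₀ = χ₁.1 z₀ at h'
    rw [MonoidHom.one_apply] at h'
    exact hz₀ h'.symm
  have hN₁ : augmentation (Lf.single 1).omega (Lf.single 1).S.scalar (Lf.single 1).chi = ⊥ :=
    augmentation_eq_bot_of_character (Lf.single 1) Λ hω₁ hcen
  have hg₀ : Λ g₀ ≠ (1 : S.U →* ℂˣ) g₀ := by
    rw [MonoidHom.one_apply]
    exact hΛg₀
  have hnotiso : ¬ AreIsomorphicRep (Lf.quot 1) (Lf.quot 0) :=
    not_areIsomorphicRep_quotRep_of_characters ω₁ ω₀ S.scalar_mem_center χ₁.1 (1 : S.normOne →* ℂˣ) Λ 1 hω₁ hω₀ hN₁ hg₀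
  have hItem1 : Lf.Item1AsPrinted := by
    intro i
    fin_cases i
    · exact lemD1_1AsPrinted_of_character_of_rank_ne_two' (Lf.single 0) 1 hω₀ (fun z => rfl)
        ⟨Set.univ, isOpen_univ, Set.mem_univ _, fun g _ => rfl⟩ hN2
    · exact lemD1_1AsPrinted_of_character_of_rank_ne_two' (Lf.single 1) Λ hω₁ hcen hopen hN2
  have hsame : ∀ k l : Fin 2, LemD1.SameClass (Lf.eps k) (Lf.eps l) := fun k l => by
    change LemD1.SameClass (⟨e₁, he₁⟩ : LemD1.EpsRep S) ⟨e₁, he₁⟩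
    exact ⟨1, by simp⟩
  have hrefl : ∀ k : Fin 2, (AreIsomorphicRep (Lf.quot k) (Lf.quot k) ↔
      (Lf.mu k = Lf.mu k ∧ LemD1.SameClass (Lf.eps k) (Lf.eps k) ∧ Lf.chi k = Lf.chi k)) :=
    fun k => iff_of_true ⟨LinearEquiv.refl ℂ _, fun _ _ => rfl⟩ ⟨rfl, hsame k k, rfl⟩
  have hItem3 : LemD1_3AsPrintedI Lf := by
    intro _ i j
    fin_cases i <;> fin_cases j
    · exact hrefl 0
    · exact iff_of_false hnotiso fun h => hχne h.2.2.symm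
    · exact iff_of_false (fun h => hnotiso h.symm) fun h => hχne h.2.2
    · exact hrefl 1
  exact ⟨Lf, rfl, fun _ => rfl, fun _ => rfl, rfl, hItem1, hItem3, rfl, hsame 0 1, hχne, hnotiso⟩

include hcδ in
/-- **Consequence — EVERY place, EVERY `N ≥ 3`, NO hypothesis on `μ`** (the Step-2 index set is non-empty at every place,
✔ `…NormClassExtensionDyadic.nonempty_muSet`): the records (1) ∧ (3) read on an indexed collection over the place model do NOT by their
shape force «all members carry the same Step-3 character `χ`» (✔ `…LevelCarrier` gave this for `N` odd via `χ_Λ(−1) = −1`).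
[cite: Liu2021, App. D Lemma D.1 (1) and (3) (l. 5229, 5233)] -/
theorem not_forall_chi_eq (w : PlacesOver E v) (h3 : 3 ≤ N) :
    ¬ ∀ Lf : LemD1IndexedFamily (v.adicCompletion F) (LocalRing E v) N (Fin 2),
        Lf.S = LemD1OfPlace.standingData E v c N J hcδ hδ hN hJh hJdet →
        Lf.Item1AsPrinted → LemD1_3AsPrintedI Lf → ∀ i j : Fin 2, Lf.chi i = Lf.chi j := by
  obtain ⟨μ⟩ := LemD1IndexedNonVacuityNormClassExtensionDyadic.nonempty_muSet E v c hcδ hδ N J hN hJh hJdet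
  intro h
  obtain ⟨Lf, hS, -, -, -, h1, h3', -, -, hne, -⟩ :=
    exists_lemD1IndexedFamily_item1_and_lemD1_3_chi E v c hcδ hδ N J hN hJh hJdet w h3 μ
      (LemD1OfPlace.epsDelta E v c N J hcδ hδ hN hJh hJdet)
  exact hne (h Lf hS h1 h3' 0 1)

include hcδ in
/-- **… nor «non-isomorphic `ω`'s ⟹ different `μ` or different `ε`-class»** (the `χ`-conjunct of (3) is load-bearing: the two members of
§3 have the same `μ`, the same `ε`, and non-isomorphic carriers) — every place, every `N ≥ 3`. [cite: Liu2021, App. D Lemma D.1 (1) and (3) (l. 5229, 5233)] -/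
theorem not_forall_mu_ne_or_not_sameClass_of_not_areIsomorphicRep (w : PlacesOver E v) (h3 : 3 ≤ N) :
    ¬ ∀ Lf : LemD1IndexedFamily (v.adicCompletion F) (LocalRing E v) N (Fin 2),
        Lf.S = LemD1OfPlace.standingData E v c N J hcδ hδ hN hJh hJdet →
        Lf.Item1AsPrinted → LemD1_3AsPrintedI Lf →
        ∀ i j : Fin 2, ¬ AreIsomorphicRep (Lf.quot j) (Lf.quot i) →
          (Lf.mu i ≠ Lf.mu j ∨ ¬ LemD1.SameClass (Lf.eps i) (Lf.eps j)) := by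
  obtain ⟨μ⟩ := LemD1IndexedNonVacuityNormClassExtensionDyadic.nonempty_muSet E v c hcδ hδ N J hN hJh hJdet
  intro h
  obtain ⟨Lf, hS, -, -, -, h1, h3', hμ, hsame, -, hnot⟩ :=
    exists_lemD1IndexedFamily_item1_and_lemD1_3_chi E v c hcδ hδ N J hN hJh hJdet w h3 μ
      (LemD1OfPlace.epsDelta E v c N J hcδ hδ hN hJh hJdet)
  rcases h Lf hS h1 h3' 0 1 hnot with hμne | hε
  · exact hμne hμ
  · exact hε hsame

end PlaceModel

/-! ## §4 The CM rows: the `χ`-alone certificate with the rows' OWN `μ_v` in BOTH members — EVERY place of `L⁺`, EVERY `N ≥ 3` -/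

section CM

open Literature.NumberTheory.GelbartRogawski1991.UnitaryDualPair (imagUnit complexConj_imagUnit imagUnit_ne_zero)
open Literature.NumberTheory.GelbartRogawski1991.UnitaryDualPair.LocalSplitting (localMu norm_localMu continuous_localMu
  localMu_toLocalRing_eq_one_iff)
open Literature.NumberTheory.Automorphic.IdeleClassGroup (toHeckeCharacter isUnitary_toHeckeCharacter IsConjugateSymplectic)
open Literature.RepresentationTheory.Liu2021 (isOscillatorChar_toHeckeCharacter_iff)

variable (L : Type) [Field L] [NumberField L] [IsCMField L]

local notation3 "cc" => (IsCMField.complexConj L)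
local notation3 "L⁺" => (↥(maximalRealSubfield L))

variable (v : HeightOneSpectrum (𝓞 (maximalRealSubfield L))) (N : ℕ) (J : Matrix (Fin N) (Fin N) L) (hN : 2 ≤ N)
  (hJh : (J.map (IsCMField.complexConj L))ᵀ = J) (hJdet : J.det ≠ 0)

/-- **the `χ`-alone certificate with the rows' OWN `μ_v = localMu L (toHeckeCharacter L ψ) v` in BOTH members — EVERY place `v` of `L⁺`,
EVERY `N ≥ 3`** (every conjugate symplectic `ψ`; in particular the END's `N = 3` and every even rank): labels `(μ_v, ε, 1)`, `(μ_v, ε, χ_Λ)`,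
carriers the trivial line and the line of `Λ`. [cite: Liu2021, App. D Lemma D.1 (1) and (3) (l. 5229, 5233); Def. 4.11 (l. 2086)] -/
theorem exists_lemD1IndexedFamily_item1_and_lemD1_3_localMu_chi (h3 : 3 ≤ N)
    (ψ : IdeleClassGroup L →ₜ* Circle) (hψ : IsConjugateSymplectic L ψ) :
    ∃ Lf : LemD1IndexedFamily (v.adicCompletion L⁺) (LocalRing L v) N (Fin 2),
      Lf.S = LemD1OfPlace.standingData L v cc N J (complexConj_imagUnit L) (imagUnit_ne_zero L) hN hJh hJdet ∧
      (∀ i, (Lf.eps i).1 = LemD1OfPlace.eps L v (imagUnit_ne_zero L)) ∧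
      (∀ i, (Lf.mu i).1 = localMu L (toHeckeCharacter L ψ) v) ∧ (Lf.chi 0).1 = 1 ∧
      Lf.Item1AsPrinted ∧ LemD1_3AsPrintedI Lf ∧
      Lf.mu 0 = Lf.mu 1 ∧ LemD1.SameClass (Lf.eps 0) (Lf.eps 1) ∧ Lf.chi 0 ≠ Lf.chi 1 ∧
      ¬ AreIsomorphicRep (Lf.quot 1) (Lf.quot 0) := by
  obtain ⟨w⟩ := (inferInstance : Nonempty (PlacesOver L v))
  exact exists_lemD1IndexedFamily_item1_and_lemD1_3_chi L v cc (complexConj_imagUnit L) (imagUnit_ne_zero L) N J hN hJh hJdet w h3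
    (LemD1OfPlace.muOf L v cc N J (complexConj_imagUnit L) (imagUnit_ne_zero L) hN hJh hJdet
      (localMu L (toHeckeCharacter L ψ) v)
      (fun x => norm_localMu L (toHeckeCharacter L ψ) v (isUnitary_toHeckeCharacter L ψ) x)
      (continuous_localMu L (toHeckeCharacter L ψ) v)
      (fun t => localMu_toLocalRing_eq_one_iff L (toHeckeCharacter L ψ) v
        ((isOscillatorChar_toHeckeCharacter_iff ψ).mpr hψ) t))
    (LemD1OfPlace.epsDelta L v cc N J (complexConj_imagUnit L) (imagUnit_ne_zero L) hN hJh hJdet)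

/-- **the records `hD1''` ∕ `hD3` read at the rows' slot types do not force «all members carry the same `χ`» — at ANY place `v` of `L⁺`,
for ANY `N ≥ 3`** (no parity condition). [cite: Liu2021, App. D Lemma D.1 (1) and (3) (l. 5229, 5233)] -/
theorem not_forall_chi_eq_of_isCMField (h3 : 3 ≤ N) :
    ¬ ∀ Lf : LemD1IndexedFamily (v.adicCompletion L⁺) (LocalRing L v) N (Fin 2),
        Lf.S = LemD1OfPlace.standingData L v cc N J (complexConj_imagUnit L) (imagUnit_ne_zero L) hN hJh hJdet →
        Lf.Item1AsPrinted → LemD1_3AsPrintedI Lf → ∀ i j : Fin 2, Lf.chi i = Lf.chi j := by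
  obtain ⟨w⟩ := (inferInstance : Nonempty (PlacesOver L v))
  exact not_forall_chi_eq L v cc (complexConj_imagUnit L) (imagUnit_ne_zero L) N J hN hJh hJdet w h3

/-- **… nor «non-isomorphic carriers ⟹ different `μ` or different `ε`-class»** at ANY place of `L⁺`, ANY `N ≥ 3`.
[cite: Liu2021, App. D Lemma D.1 (1) and (3) (l. 5229, 5233)] -/
theorem not_forall_mu_ne_or_not_sameClass_of_not_areIsomorphicRep_of_isCMField (h3 : 3 ≤ N) :
    ¬ ∀ Lf : LemD1IndexedFamily (v.adicCompletion L⁺) (LocalRing L v) N (Fin 2),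
        Lf.S = LemD1OfPlace.standingData L v cc N J (complexConj_imagUnit L) (imagUnit_ne_zero L) hN hJh hJdet →
        Lf.Item1AsPrinted → LemD1_3AsPrintedI Lf →
        ∀ i j : Fin 2, ¬ AreIsomorphicRep (Lf.quot j) (Lf.quot i) →
          (Lf.mu i ≠ Lf.mu j ∨ ¬ LemD1.SameClass (Lf.eps i) (Lf.eps j)) := by
  obtain ⟨w⟩ := (inferInstance : Nonempty (PlacesOver L v))
  exact not_forall_mu_ne_or_not_sameClass_of_not_areIsomorphicRep L v cc (complexConj_imagUnit L) (imagUnit_ne_zero L) N J hN hJh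
    hJdet w h3

/-- **the `∀ v` form**: at EVERY finite place of `L⁺` simultaneously, for EVERY `N ≥ 3`. [cite: Liu2021, App. D Lemma D.1 (1) and (3) (l. 5229, 5233)] -/
theorem forall_not_forall_chi_eq_of_isCMField (h3 : 3 ≤ N) :
    ∀ v : HeightOneSpectrum (𝓞 L⁺),
      ¬ ∀ Lf : LemD1IndexedFamily (v.adicCompletion L⁺) (LocalRing L v) N (Fin 2),
          Lf.S = LemD1OfPlace.standingData L v cc N J (complexConj_imagUnit L) (imagUnit_ne_zero L) hN hJh hJdet →
          Lf.Item1AsPrinted → LemD1_3AsPrintedI Lf → ∀ i j : Fin 2, Lf.chi i = Lf.chi j :=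
  fun v => not_forall_chi_eq_of_isCMField L v N J hN hJh hJdet h3

end CM

end Literature.NumberTheory.Automorphic.Liu2021.LemD1IndexedNonVacuityChiAlone

end
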